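import Summits.MatrixMultiplication.OmegaCensus.STPPRankPeel
import Literature.Computability.AlgebraicComplexity.BorderRankMatMulTwoApolarity
import Literature.Computability.AlgebraicComplexity.BorderRankMatMul223Apolarity
import Literature.Computability.AlgebraicComplexity.BorderRankMatMul323Apolarity

/-!
# ω-census (abelian STPP census, seat stpp-2), filter N7 part 2: thin STPP families never beat the sum of the cubes

HONEST FRAMING (pub-omega census; verbatim): lottery ticket; floor = certified bounds/negative ranges.
Census BOOKKEEPING (pub-omega stpp-2 gen 16, 2026-08-26): a necessary condition ("filter N7") for the finite STPP
census of abelian groups, in the kernel.  Nothing here is progress on `ω`.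

For an STPP family `(Aᵢ, Bᵢ, Cᵢ)_{i<N}` (CKSU 2005 Def. 5.1, the tree's `IsSTPP`) with non-empty sets in a finite
abelian group `H` the tree proves `R(⊕ᵢ ⟨|Aᵢ|,|Bᵢ|,|Cᵢ|⟩) ≤ |H|` (`tensorRank_matMulDirectSum_le_card_of_isSTPP`,
CKSU Thm. 5.3/5.5); `STPPRankPeel.lean` (with `STPPRankProjection.lean`) bounds the left-hand side below.  Hence ("filter N7"; a triple is THIN if
one of its sets is a singleton, FAT otherwise):

* `STPPRank.sum_gain_le_card_of_isSTPP` — `∑ᵢ gain(dᵢ; |Aᵢ|,|Bᵢ|,|Cᵢ|) ≤ |H|` for every choice of directions;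
* `STPPRank.tensorRank_add_sum_gain_le_card_of_isSTPP` — `R(⟨|A_{j₀}|,|B_{j₀}|,|C_{j₀}|⟩) + ∑_{i ≠ j₀} gain ≤ |H|`;
  with the tree's border ranks `R̲(⟨2,2,2⟩) ≥ 7`, `R̲(⟨2,2,3⟩) ≥ 10`, `R̲(⟨2,3,3⟩) ≥ 14`:
  `seven_add_sum_gain_le_card_of_isSTPP`, `ten_add_sum_gain_le_card_of_isSTPP`, `fourteen_add_sum_gain_le_card_of_isSTPP`;
* `STPPRank.sum_card_mul_le_card_of_isSTPP_of_thin` — **an all-thin STPP family satisfies `∑ᵢ |Aᵢ||Bᵢ||Cᵢ| ≤ |H|`,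
  i.e. never beats `∑ d_k³ = |H|`** (CKSU Thm. 5.5 gives no exponent bound below `3` from it);
* `STPPRank.no_isSTPP_144_414_551` — example: a minimal undecided beating leaf of the cell's ℤ₅₄ frontier
  (`{(1,4,4),(4,1,4),(5,5,1)}`, `∑ abc = 57`, left undecided by the DFS engines) is impossible in every abelian group
  of order `≤ 56`, by this theorem instead of a search.
On the cell's open frontiers (bundle parts-56, 2026-08-26) the kernel-grade filter decides 31 of the 6 668 ℤ₅₄ leaves
and 45 of the 634 ℤ₅₅ leaves (note `HOME/pub-omega-stpp-2-g16/n7/N7-RANK-FILTER.md`).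
-/

noncomputable section

open scoped BigOperators

namespace Summit.MatrixMultiplication.OmegaCensus.STPPRank

open Literature.Computability.AlgebraicComplexity Module Finset

/-! ## §4 The census filter N7: STPP families in finite abelian groups -/

section STPP

variable {H : Type*} [AddCommGroup H] [Fintype H] [DecidableEq H] {N : ℕ}

omit [AddCommGroup H] [Fintype H] [DecidableEq H] in
/-- Positivity of the formats of a family with non-empty sets. [folklore] -/
theorem card_pos_of_nonempty {A B C : Fin N → Finset H}
    (hne : ∀ i, (A i).Nonempty ∧ (B i).Nonempty ∧ (C i).Nonempty) (i : Fin N) :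
    0 < (A i).card ∧ 0 < (B i).card ∧ 0 < (C i).card :=
  ⟨Finset.card_pos.2 (hne i).1, Finset.card_pos.2 (hne i).2.1, Finset.card_pos.2 (hne i).2.2⟩

/-- **Filter N7, all blocks peeled (kernel).** For an STPP family with non-empty sets in a finite abelian group `H`
and every choice of flattening directions, `∑ᵢ gain(dᵢ; |Aᵢ|,|Bᵢ|,|Cᵢ|) ≤ |H|` — CKSU Thm. 5.3/5.5
(`tensorRank_matMulDirectSum_le_card_of_isSTPP`) composed with `sum_gain_le_tensorRank`.
[cite: CohnKleinbergSzegedyUmans2005, Thm. 5.5] [cite: BuczynskiPostinghelRupniewski2020, §3.1 (first Lemma)] -/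
theorem sum_gain_le_card_of_isSTPP (A B C : Fin N → Finset H) (hS : IsSTPP A B C)
    (hne : ∀ i, (A i).Nonempty ∧ (B i).Nonempty ∧ (C i).Nonempty) (d : Fin N → Fin 3) :
    ∑ i, gain (d i) (A i).card (B i).card (C i).card ≤ Fintype.card H :=
  (sum_gain_le_tensorRank (K := ℂ) (card_pos_of_nonempty hne) d).trans
    (tensorRank_matMulDirectSum_le_card_of_isSTPP A B C hS)

/-- **Filter N7 with one distinguished block (kernel).** For an STPP family with non-empty sets in a finite abelian
`H`, a block `j₀` and directions `d` for the other blocks: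
`R(⟨|A_{j₀}|,|B_{j₀}|,|C_{j₀}|⟩) + ∑_{i ≠ j₀} gain(dᵢ; |Aᵢ|,|Bᵢ|,|Cᵢ|) ≤ |H|`.
[cite: CohnKleinbergSzegedyUmans2005, Thm. 5.5] [cite: BuczynskiPostinghelRupniewski2020, §3.1 (first Lemma)] -/
theorem tensorRank_add_sum_gain_le_card_of_isSTPP (A B C : Fin N → Finset H) (hS : IsSTPP A B C)
    (hne : ∀ i, (A i).Nonempty ∧ (B i).Nonempty ∧ (C i).Nonempty) (d : Fin N → Fin 3) (j₀ : Fin N) :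
    tensorRank (matMulTensor ℂ (A j₀).card (B j₀).card (C j₀).card) +
        ∑ i ∈ Finset.univ.erase j₀, gain (d i) (A i).card (B i).card (C i).card ≤ Fintype.card H :=
  (tensorRank_add_sum_gain_le_tensorRank (K := ℂ) (card_pos_of_nonempty hne) d j₀).trans
    (tensorRank_matMulDirectSum_le_card_of_isSTPP A B C hS)

/-- The direction in which a THIN block `⟨a,b,c⟩` (`min(a,b,c) = 1`) is peeled at its full volume: `a = 1` — third
index (`bc` slices), `b = 1` — first index (`ac`), `c = 1` — second index (`ab`). [folklore] -/
def thinDir (a b _c : ℕ) : Fin 3 := if a = 1 then 2 else if b = 1 then 0 else 1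

/-- A thin block peels at its full volume `abc`. [folklore] -/
theorem gain_thinDir {a b c : ℕ} (h : a = 1 ∨ b = 1 ∨ c = 1) : gain (thinDir a b c) a b c = a * b * c := by
  unfold thinDir gain
  by_cases ha : a = 1
  · subst ha; simp
  · by_cases hb : b = 1
    · subst hb; simp [ha]
    · have hc : c = 1 := by tauto
      subst hc; simp [ha, hb]

/-- **All-thin STPP families never beat the sum of the cubes (kernel).** If every triple of an STPP family with
non-empty sets in a finite abelian group `H` has a set of size `1`, then `∑ᵢ |Aᵢ| |Bᵢ| |Cᵢ| ≤ |H|` (`= ∑_k d_k³`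
for abelian `H`), i.e. CKSU's Thm. 5.5 yields no bound below `3` from such a family.
[cite: CohnKleinbergSzegedyUmans2005, Thm. 5.5] [cite: BuczynskiPostinghelRupniewski2020, §3.1 (first Lemma)] -/
theorem sum_card_mul_le_card_of_isSTPP_of_thin (A B C : Fin N → Finset H) (hS : IsSTPP A B C)
    (hne : ∀ i, (A i).Nonempty ∧ (B i).Nonempty ∧ (C i).Nonempty)
    (hthin : ∀ i, (A i).card = 1 ∨ (B i).card = 1 ∨ (C i).card = 1) :
    ∑ i, (A i).card * (B i).card * (C i).card ≤ Fintype.card H := by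
  have h := sum_gain_le_card_of_isSTPP A B C hS hne (fun i => thinDir (A i).card (B i).card (C i).card)
  have e : ∑ i, gain (thinDir (A i).card (B i).card (C i).card) (A i).card (B i).card (C i).card =
      ∑ i, (A i).card * (B i).card * (C i).card :=
    Finset.sum_congr rfl fun i _ => gain_thinDir (hthin i)
  omega

/-- `R(⟨2,2,2⟩) ≥ 7` over `ℂ` in the tree (border rank `≥ 7`, Landsberg 2006, via the tree's torus-fixed border
apolarity certificate `MatMulTwo.seven_le_algBorderRank_matMulTensor_two`; rank `≥` border rank).
[cite: Landsberg2005, main theorem (p. 447)] -/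
theorem seven_le_tensorRank_matMulTensor_222 : 7 ≤ tensorRank (matMulTensor ℂ 2 2 2) :=
  (MatMulTwo.seven_le_algBorderRank_matMulTensor_two ℂ).trans (algBorderRank_le_tensorRank _)

/-- `R(⟨2,2,3⟩), R(⟨2,3,2⟩), R(⟨3,2,2⟩) ≥ 10` over `ℂ` in the tree (border rank of `⟨2,2,3⟩` is `10`,
Conner–Harper–Landsberg 2023 Thm. 1.3, via the tree's `MatMul223.ten_le_algBorderRank_matMulTensor_223`;
the other formats by Bläser 2013 Lemma 5.5, `Blaser2013_lemma55`). [cite: ConnerHarperLandsberg2023, Thm. 1.3] -/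
theorem ten_le_tensorRank_matMulTensor_223_perm :
    10 ≤ tensorRank (matMulTensor ℂ 2 2 3) ∧ 10 ≤ tensorRank (matMulTensor ℂ 2 3 2) ∧
      10 ≤ tensorRank (matMulTensor ℂ 3 2 2) := by
  have h223 : 10 ≤ tensorRank (matMulTensor ℂ 2 2 3) :=
    (MatMul223.ten_le_algBorderRank_matMulTensor_223 ℂ).trans (algBorderRank_le_tensorRank _)
  obtain ⟨h1, h2, -⟩ := Blaser2013_lemma55 (K := ℂ) 2 2 3
  exact ⟨h223, h2 ▸ h223, h1 ▸ h223⟩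

/-- **Filter N7 with one `⟨2,2,2⟩` block (kernel grade):** `7 + ∑_{i ≠ j₀} gain(dᵢ; |Aᵢ|,|Bᵢ|,|Cᵢ|) ≤ |H|`.
[cite: CohnKleinbergSzegedyUmans2005, Thm. 5.5] [cite: BuczynskiPostinghelRupniewski2020, §3.1 (first Lemma)] -/
theorem seven_add_sum_gain_le_card_of_isSTPP (A B C : Fin N → Finset H) (hS : IsSTPP A B C)
    (hne : ∀ i, (A i).Nonempty ∧ (B i).Nonempty ∧ (C i).Nonempty) (d : Fin N → Fin 3) (j₀ : Fin N)
    (h2 : (A j₀).card = 2 ∧ (B j₀).card = 2 ∧ (C j₀).card = 2) :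
    7 + ∑ i ∈ Finset.univ.erase j₀, gain (d i) (A i).card (B i).card (C i).card ≤ Fintype.card H := by
  have h := tensorRank_add_sum_gain_le_card_of_isSTPP A B C hS hne d j₀
  rw [h2.1, h2.2.1, h2.2.2] at h
  have h7 := seven_le_tensorRank_matMulTensor_222
  omega

/-- **Filter N7 with one `⟨2,2,3⟩`-type block (kernel grade):** `10 + ∑_{i ≠ j₀} gain(dᵢ; |Aᵢ|,|Bᵢ|,|Cᵢ|) ≤ |H|`
for a block of format `(2,2,3)`, `(2,3,2)` or `(3,2,2)`.
[cite: CohnKleinbergSzegedyUmans2005, Thm. 5.5] [cite: BuczynskiPostinghelRupniewski2020, §3.1 (first Lemma)] -/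
theorem ten_add_sum_gain_le_card_of_isSTPP (A B C : Fin N → Finset H) (hS : IsSTPP A B C)
    (hne : ∀ i, (A i).Nonempty ∧ (B i).Nonempty ∧ (C i).Nonempty) (d : Fin N → Fin 3) (j₀ : Fin N)
    (h223 : ((A j₀).card = 2 ∧ (B j₀).card = 2 ∧ (C j₀).card = 3) ∨
      ((A j₀).card = 2 ∧ (B j₀).card = 3 ∧ (C j₀).card = 2) ∨
      ((A j₀).card = 3 ∧ (B j₀).card = 2 ∧ (C j₀).card = 2)) :
    10 + ∑ i ∈ Finset.univ.erase j₀, gain (d i) (A i).card (B i).card (C i).card ≤ Fintype.card H := by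
  have h := tensorRank_add_sum_gain_le_card_of_isSTPP A B C hS hne d j₀
  obtain ⟨h1, h2, h3⟩ := ten_le_tensorRank_matMulTensor_223_perm
  rcases h223 with ⟨ha, hb, hc⟩ | ⟨ha, hb, hc⟩ | ⟨ha, hb, hc⟩ <;> rw [ha, hb, hc] at h <;> omega

/-- `R(⟨2,3,3⟩), R(⟨3,2,3⟩), R(⟨3,3,2⟩) ≥ 14` over `ℂ` in the tree (border rank of `⟨2,3,3⟩` is `≥ 14`, via the tree's
`MatMul323.fourteen_le_algBorderRank_matMulTensor_233`; the other formats by Bläser 2013 Lemma 5.5).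
[cite: Blaser2013, Lemma 5.5] -/
theorem fourteen_le_tensorRank_matMulTensor_233_perm :
    14 ≤ tensorRank (matMulTensor ℂ 2 3 3) ∧ 14 ≤ tensorRank (matMulTensor ℂ 3 2 3) ∧
      14 ≤ tensorRank (matMulTensor ℂ 3 3 2) := by
  have h233 : 14 ≤ tensorRank (matMulTensor ℂ 2 3 3) :=
    (MatMul323.fourteen_le_algBorderRank_matMulTensor_233 ℂ).trans (algBorderRank_le_tensorRank _)
  obtain ⟨h1, h2, -⟩ := Blaser2013_lemma55 (K := ℂ) 2 3 3
  exact ⟨h233, h1 ▸ h233, h2 ▸ h233⟩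

/-- **Filter N7 with one `⟨2,3,3⟩`-type block (kernel grade):** `14 + ∑_{i ≠ j₀} gain(dᵢ; |Aᵢ|,|Bᵢ|,|Cᵢ|) ≤ |H|`
for a block of format `(2,3,3)`, `(3,2,3)` or `(3,3,2)`.
[cite: CohnKleinbergSzegedyUmans2005, Thm. 5.5] [cite: BuczynskiPostinghelRupniewski2020, §3.1 (first Lemma)] -/
theorem fourteen_add_sum_gain_le_card_of_isSTPP (A B C : Fin N → Finset H) (hS : IsSTPP A B C)
    (hne : ∀ i, (A i).Nonempty ∧ (B i).Nonempty ∧ (C i).Nonempty) (d : Fin N → Fin 3) (j₀ : Fin N)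
    (h233 : ((A j₀).card = 2 ∧ (B j₀).card = 3 ∧ (C j₀).card = 3) ∨
      ((A j₀).card = 3 ∧ (B j₀).card = 2 ∧ (C j₀).card = 3) ∨
      ((A j₀).card = 3 ∧ (B j₀).card = 3 ∧ (C j₀).card = 2)) :
    14 + ∑ i ∈ Finset.univ.erase j₀, gain (d i) (A i).card (B i).card (C i).card ≤ Fintype.card H := by
  have h := tensorRank_add_sum_gain_le_card_of_isSTPP A B C hS hne d j₀
  obtain ⟨h1, h2, h3⟩ := fourteen_le_tensorRank_matMulTensor_233_perm
  rcases h233 with ⟨ha, hb, hc⟩ | ⟨ha, hb, hc⟩ | ⟨ha, hb, hc⟩ <;> rw [ha, hb, hc] at h <;> omega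

/-- **Example (a ℤ₅₄ frontier leaf of the cell's census, decided by N7 instead of a search).** No abelian group of
order `≤ 56` carries an STPP family of pattern `{(1,4,4), (4,1,4), (5,5,1)}` (`∑ abc = 57`); the cell's DFS engines
left this pattern undecided in `ℤ₅₄`. [cite: CohnKleinbergSzegedyUmans2005, Def. 5.1] -/
theorem no_isSTPP_144_414_551 (hH : Fintype.card H ≤ 56) (A B C : Fin 3 → Finset H) (hS : IsSTPP A B C)
    (hA : ∀ i, (A i).card = ![1, 4, 5] i) (hB : ∀ i, (B i).card = ![4, 1, 5] i)
    (hC : ∀ i, (C i).card = ![4, 4, 1] i) : False := by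
  have hne : ∀ i, (A i).Nonempty ∧ (B i).Nonempty ∧ (C i).Nonempty := by
    intro i
    refine ⟨Finset.card_pos.1 ?_, Finset.card_pos.1 ?_, Finset.card_pos.1 ?_⟩
    · rw [hA]; fin_cases i <;> simp
    · rw [hB]; fin_cases i <;> simp
    · rw [hC]; fin_cases i <;> simp
  have hthin : ∀ i, (A i).card = 1 ∨ (B i).card = 1 ∨ (C i).card = 1 := by
    intro i; fin_cases i <;> simp [hA, hB, hC]
  have h := sum_card_mul_le_card_of_isSTPP_of_thin A B C hS hne hthin
  simp only [Fin.sum_univ_three, hA, hB, hC] at h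
  simp at h
  omega

end STPP

end Summit.MatrixMultiplication.OmegaCensus.STPPRank

end
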